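import Summits.AnomalousDissipation.AnomalousDissipation.Theses.FrustratedForces
import Summits.AnomalousDissipation.AnomalousDissipation.Theses.VirtualDissipation
import Summits.AnomalousDissipation.AnomalousDissipation.Theorems.MirrorVarietySteadyWeakIsGlobalLerayHopf
import Literature.Analysis.FluidPDE.SteadyNavierStokesEnergy
import Literature.Analysis.FluidPDE.StatisticalSolutionDirac
import Literature.Analysis.FluidPDE.StatisticalSolutionEnergyEq
import Literature.Analysis.FluidPDE.DoeringFoiasPowerProofs
import HarnessLib.Audit

/-!
# Typed statements behind `STRATEGY-CENSUS.md` — crux `GPLoudFamilyZ` (stmt-AnomalousDissipation-10436), crux-strategist, 2026-08-17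

Props and short proofs only; every constant is a tree declaration; no `sorry`.

* §Strengthen   `HeavySteadyStatesGP` (PDE form of the registered stub 1 of line `fat-half-branch`), `FatSteadyStatesGP`
                 (the blow-down scaling of the fat ABC half-branch, kit j015722), `heavy_of_fat` (PROVED), `poincare_of_mem_energySpaceV`
                 (PROVED), `GPLoudFamilyZ_of_heavy` (PROVED: heavy steady states ⇒ the crux, no floor statement anywhere).
* §Negation     `GPAsymptoticallyQuiet` (= ¬crux up to bookkeeping: `not_GPLoudFamilyZ_of_quiet`, `GPLoudFamilyZ_of_not_quiet`, both PROVED)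
                 and the ROUTE CONSEQUENCE `GPLoudEnergyCeilingZ_false_of_heavy` (PROVED: heavy steady states refute crux #3 of the
                 same route — a ready `--negative-modulo HeavySteadyStatesGP` lemma for cdisprove on stmt-AnomalousDissipation-13924).
* §Decomposition `GPLoudFamilyZ_of_virtualDissipation` (PROVED): the two cruxes of route VirtualDissipation (LambRigidGP stmt-15150,
                 LightSteadyStatesGP stmt-15151) imply this crux — the typed split recorded (not filed) in the census.
-/

set_option linter.dupNamespace false

noncomputable section

open Filter Set Topology MeasureTheory

namespace Summit.AnomalousDissipation.AnomalousDissipation.Cruxes.GPLoudFamilyZ.StrategyCensus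

open Summit.AnomalousDissipation.AnomalousDissipation.Theses

local notation "Vec3" => (UnitAddTorus (Fin 3) → EuclideanSpace ℝ (Fin 3))
local notation "L2T3" => (MeasureTheory.Lp (EuclideanSpace ℝ (Fin 3)) 2 (MeasureTheory.volume : MeasureTheory.Measure (UnitAddTorus (Fin 3))))

/-- The pinned Galloway–Proctor / Archontis force `f_GP = sin(2πx₂)e₀ + sin(2πx₀)e₁ + sin(2πx₁)e₂` (the route's inline sum of
three Stokes modes, abbreviated; `abbrev`, so every statement below unfolds to the route's text). -/
abbrev fGP : Vec3 := fun x =>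
  (Literature.Analysis.FluidPDE.Torus.stokesMode (Pi.single (2 : Fin 3) (1 : ℤ)) (EuclideanSpace.single (0 : Fin 3) (1 : ℝ)) false x +
    Literature.Analysis.FluidPDE.Torus.stokesMode (Pi.single (0 : Fin 3) (1 : ℤ)) (EuclideanSpace.single (1 : Fin 3) (1 : ℝ)) false x +
    Literature.Analysis.FluidPDE.Torus.stokesMode (Pi.single (1 : Fin 3) (1 : ℤ)) (EuclideanSpace.single (2 : Fin 3) (1 : ℝ)) false x :
    EuclideanSpace ℝ (Fin 3))

theorem fGP_admissible :
    Literature.Analysis.FunctionSpaces.Torus.IsSmooth fGP ∧ Literature.Analysis.FunctionSpaces.Torus.IsDivFree fGP ∧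
      Literature.Analysis.FunctionSpaces.Torus.HasZeroMean fGP :=
  Summit.AnomalousDissipation.AnomalousDissipation.Theorems.SteadyStatesLoudBounded.GpAdmissible.stub_gpAdmissible

/-! ## §Strengthen — heavy and fat steady states (PDE forms of the registered line's stub 1) -/

/-- **HEAVY steady states of `f_GP` at arbitrarily small viscosity** (PDE form of `stub_heavySteadyGalerkinStatesGP`): for some
`c > 0` and every `ν₀ > 0` some `ν ∈ (0, ν₀)` carries a steady weak solution `u ∈ V` of `NS_ν(f_GP)` of energy `≥ c/ν`. -/
def HeavySteadyStatesGP : Prop :=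
  ∃ c : ℝ, 0 < c ∧ ∀ ν₀ : ℝ, 0 < ν₀ → ∃ ν : ℝ, 0 < ν ∧ ν < ν₀ ∧
    ∃ u : ↥(Literature.Analysis.FunctionSpaces.Torus.energySpace (Fin 3)),
      (u : L2T3) ∈ Literature.Analysis.FunctionSpaces.Torus.energySpaceV (Fin 3) ∧
      Literature.Analysis.FluidPDE.Torus.IsSteadyWeakSolution ν fGP u ∧ c ≤ ν * ∫ x, ‖(u : L2T3) x‖ ^ 2

/-- **FAT steady states of `f_GP`** (Grashof-scale energy, the scaling of the numerically continued ABC half-branch: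
`ν²∫|u_ν|² → ‖h₊‖²/(16π⁴) = 0.75/(2π)⁴ ≈ 4.8·10⁻⁴` on the unit torus, kit j015722): `c ≤ ν² ∫|u|²` at arbitrarily small `ν`.
Its negation restricted to `c → 0` is crux #2 `GPSteadySubGrashof` of the same route. -/
def FatSteadyStatesGP : Prop :=
  ∃ c : ℝ, 0 < c ∧ ∀ ν₀ : ℝ, 0 < ν₀ → ∃ ν : ℝ, 0 < ν ∧ ν < ν₀ ∧
    ∃ u : ↥(Literature.Analysis.FunctionSpaces.Torus.energySpace (Fin 3)),
      (u : L2T3) ∈ Literature.Analysis.FunctionSpaces.Torus.energySpaceV (Fin 3) ∧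
      Literature.Analysis.FluidPDE.Torus.IsSteadyWeakSolution ν fGP u ∧ c ≤ ν ^ 2 * ∫ x, ‖(u : L2T3) x‖ ^ 2

/-- Fat ⇒ heavy (take `ν < min ν₀ 1`; then `ν²E ≤ νE`). -/
theorem heavy_of_fat : FatSteadyStatesGP → HeavySteadyStatesGP := by
  rintro ⟨c, hc, h⟩
  refine ⟨c, hc, fun ν₀ hν₀ => ?_⟩
  obtain ⟨ν, hν, hlt, u, hV, hsol, hcE⟩ := h (min ν₀ 1) (lt_min hν₀ one_pos)
  refine ⟨ν, hν, hlt.trans_le (min_le_left _ _), u, hV, hsol, hcE.trans ?_⟩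
  have hE : 0 ≤ ∫ x, ‖(u : L2T3) x‖ ^ 2 := integral_nonneg fun x => sq_nonneg _
  have hν1 : ν ≤ 1 := (hlt.trans_le (min_le_right _ _)).le
  have : ν ^ 2 ≤ ν := by nlinarith
  exact mul_le_mul_of_nonneg_right this hE

/-- **Poincaré on `V`**: `4π² ∫|u|² ≤ ‖∇u‖²` (spectral, `toReal`) for `u ∈ V ⊆ H` (mean zero, one derivative). -/
theorem poincare_of_mem_energySpaceV (u : ↥(Literature.Analysis.FunctionSpaces.Torus.energySpace (Fin 3)))
    (hV : (u : L2T3) ∈ Literature.Analysis.FunctionSpaces.Torus.energySpaceV (Fin 3)) :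
    4 * Real.pi ^ 2 * ∫ x, ‖(u : L2T3) x‖ ^ 2 ≤
      (Literature.Analysis.FunctionSpaces.Torus.eGradNormSq ((u : L2T3) : Vec3)).toReal := by
  have h1 := Literature.Analysis.FluidPDE.ofReal_integral_norm_sq_le_eGradNormSq_add (MeasureTheory.Lp.memLp (u : L2T3))
  have h0 : ∫ x, ((u : L2T3) : Vec3) x = 0 :=
    Literature.Analysis.FluidPDE.Torus.integral_eq_zero_of_mem_energySpace u.2
  rw [h0, norm_zero, zero_pow two_ne_zero, mul_zero, ENNReal.ofReal_zero, add_zero] at h1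
  have hfin : Literature.Analysis.FunctionSpaces.Torus.eGradNormSq ((u : L2T3) : Vec3) < ⊤ :=
    Literature.Analysis.FunctionSpaces.Torus.MemSobolev.eGradNormSq_lt_top hV.2
  exact (ENNReal.ofReal_le_iff_le_toReal hfin.ne).1 h1

/-- **Heavy steady states prove the crux** (no floor statement anywhere): power = dissipation = `ν‖∇u‖² ≥ 4π²·ν∫|u|² ≥ 4π²c`,
and steady weak solutions are zero-mean global Leray–Hopf constant paths (landed `steadyWeakIsGlobalLerayHopf_proof`). -/
theorem GPLoudFamilyZ_of_heavy : HeavySteadyStatesGP → FrustratedForces.GPLoudFamilyZ := by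
  rintro ⟨c, hc, hA⟩
  obtain ⟨hs, hd, hz⟩ := fGP_admissible
  have hθpos : ∀ j : ℕ, (0 : ℝ) < 1 / ((j : ℝ) + 1) := fun j => by positivity
  choose ν hpos hlt u hV hsol hcE using fun j : ℕ => hA (1 / ((j : ℝ) + 1)) (hθpos j)
  have hle1 : ∀ j, ν j ≤ 1 := fun j => by
    have h1 : 1 / ((j : ℝ) + 1) ≤ 1 := by
      rw [div_le_one (by positivity)]
      have hj : (0 : ℝ) ≤ (j : ℝ) := Nat.cast_nonneg j
      linarith
    exact ((hlt j).trans_le h1).le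
  have heq : ∀ j, ν j * (Literature.Analysis.FunctionSpaces.Torus.eGradNormSq ((u j : L2T3) : Vec3)).toReal =
      Literature.Analysis.FluidPDE.Torus.pairing (u j : L2T3) fGP := fun j =>
    Literature.Analysis.FluidPDE.Torus.IsSteadyWeakSolution.energy_eq' (by simp) (hs.memLp 2) (hV j) (hsol j)
  have hloud : ∀ j, 4 * Real.pi ^ 2 * c ≤ Literature.Analysis.FluidPDE.Torus.pairing (u j : L2T3) fGP := by
    intro j
    rw [← heq j]
    have hP := poincare_of_mem_energySpaceV (u j) (hV j)
    have hν : 0 ≤ ν j := (hpos j).le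
    have hπ : (0 : ℝ) ≤ 4 * Real.pi ^ 2 := by positivity
    calc 4 * Real.pi ^ 2 * c ≤ 4 * Real.pi ^ 2 * (ν j * ∫ x, ‖(u j : L2T3) x‖ ^ 2) := mul_le_mul_of_nonneg_left (hcE j) hπ
      _ = ν j * (4 * Real.pi ^ 2 * ∫ x, ‖(u j : L2T3) x‖ ^ 2) := by ring
      _ ≤ ν j * (Literature.Analysis.FunctionSpaces.Torus.eGradNormSq ((u j : L2T3) : Vec3)).toReal :=
          mul_le_mul_of_nonneg_left hP hν
  have hR := fun j =>
    Summit.AnomalousDissipation.AnomalousDissipation.Theorems.steadyWeakIsGlobalLerayHopf_proof (ν j) fGP (u j)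
      (hpos j) hs hz (hV j) (hsol j) (heq j)
  refine ⟨4 * Real.pi ^ 2 * c, by positivity, ν, fun j => ((u j : L2T3) : Vec3), fun j => fun _ => ((u j : L2T3) : Vec3),
    fun j => ⟨hpos j, hle1 j⟩, ?_, fun j => ?_, fun j => (hR j).1, fun j => ?_⟩
  · exact tendsto_of_tendsto_of_tendsto_of_le_of_le tendsto_const_nhds tendsto_one_div_add_atTop_nhds_zero_nat
      (fun j => (hpos j).le) (fun j => (hlt j).le)
  · exact Literature.Analysis.FluidPDE.Torus.integral_eq_zero_of_mem_energySpace (u j).2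
  · rw [(hR j).2.2, heq j]
    exact hloud j

/-! ## §Negation — the crux is a dichotomy with ASYMPTOTIC QUIETNESS; heavy steady states refute crux #3 of the route -/

/-- **Asymptotic quietness of `f_GP`** on the physical phase space: every zero-mean Leray–Hopf solution of `NS_ν(f_GP)` has mean
dissipation `< ε` once `ν < ν₀(ε)`. This is what a refuter of the crux must PROVE (`GPLoudFamilyZ_of_not_quiet`) — in particular
that EVERY steady state (fat half-branches, the light loud primary branch, …) is quiet. -/
def GPAsymptoticallyQuiet : Prop :=
  ∀ ε : ℝ, 0 < ε → ∃ ν₀ : ℝ, 0 < ν₀ ∧ ∀ ν : ℝ, 0 < ν → ν < ν₀ →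
    ∀ (u₀ : Vec3) (u : ℝ → Vec3), Literature.Analysis.FunctionSpaces.Torus.HasZeroMean u₀ →
      Literature.Analysis.FluidPDE.Torus.IsGlobalLerayHopf ν (fun _ => fGP) u₀ u →
        Literature.Analysis.FluidPDE.meanDissipation ν u < ε

theorem not_GPLoudFamilyZ_of_quiet : GPAsymptoticallyQuiet → ¬ FrustratedForces.GPLoudFamilyZ := by
  intro hQ ⟨ε, hε, ν, u₀, u, hν, hν0, hz, hLH, hεj⟩
  obtain ⟨ν₀, hν₀, hq⟩ := hQ ε hε
  obtain ⟨j, hj⟩ := ((tendsto_order.1 hν0).2 ν₀ hν₀).exists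
  exact (lt_irrefl ε) ((hεj j).trans_lt (hq (ν j) (hν j).1 hj (u₀ j) (u j) (hz j) (hLH j)))

theorem GPLoudFamilyZ_of_not_quiet : ¬ GPAsymptoticallyQuiet → FrustratedForces.GPLoudFamilyZ := by
  intro hQ
  unfold GPAsymptoticallyQuiet at hQ
  push Not at hQ
  obtain ⟨ε, hε, hA⟩ := hQ
  have hθpos : ∀ j : ℕ, (0 : ℝ) < 1 / ((j : ℝ) + 1) := fun j => by positivity
  choose ν hpos hlt u₀ u hz hLH hεu using fun j : ℕ => hA (1 / ((j : ℝ) + 1)) (hθpos j)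
  have hle1 : ∀ j, ν j ≤ 1 := fun j => by
    have h1 : 1 / ((j : ℝ) + 1) ≤ 1 := by
      rw [div_le_one (by positivity)]
      have hj : (0 : ℝ) ≤ (j : ℝ) := Nat.cast_nonneg j
      linarith
    exact ((hlt j).trans_le h1).le
  refine ⟨ε, hε, ν, u₀, u, fun j => ⟨hpos j, hle1 j⟩, ?_, hz, hLH, hεu⟩
  exact tendsto_of_tendsto_of_tendsto_of_le_of_le tendsto_const_nhds tendsto_one_div_add_atTop_nhds_zero_nat
    (fun j => (hpos j).le) (fun j => (hlt j).le)

/-- **The crux is exactly the failure of asymptotic quietness.** -/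
theorem GPLoudFamilyZ_iff_not_quiet : FrustratedForces.GPLoudFamilyZ ↔ ¬ GPAsymptoticallyQuiet :=
  ⟨fun h hQ => not_GPLoudFamilyZ_of_quiet hQ h, GPLoudFamilyZ_of_not_quiet⟩

/-- **ROUTE CONSEQUENCE: heavy steady states of `f_GP` refute crux #3 `GPLoudEnergyCeilingZ`** of route FrustratedForces
(a negative lemma of shape `H → ¬ Decl` for cdisprove's `--negative-modulo`): the heavy state at `ν < min 1 (c/(|E|+1))` is a
zero-mean Leray–Hopf constant path with `meanDissipation ≥ 4π²c` and `meanEnergy = ∫|u|² > E`. -/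
theorem GPLoudEnergyCeilingZ_false_of_heavy : HeavySteadyStatesGP → ¬ FrustratedForces.GPLoudEnergyCeilingZ := by
  rintro ⟨c, hc, hA⟩ hC
  obtain ⟨hs, hd, hz⟩ := fGP_admissible
  obtain ⟨E, hE⟩ := hC (4 * Real.pi ^ 2 * c) (by positivity)
  set ν₀ : ℝ := min 1 (c / (|E| + 1)) with hν₀
  have hEpos : 0 < |E| + 1 := by positivity
  have hν₀pos : 0 < ν₀ := lt_min one_pos (div_pos hc hEpos)
  obtain ⟨ν, hν, hlt, u, hV, hsol, hcE⟩ := hA ν₀ hν₀pos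
  have hν1 : ν ≤ 1 := (hlt.trans_le (min_le_left _ _)).le
  have heq : ν * (Literature.Analysis.FunctionSpaces.Torus.eGradNormSq ((u : L2T3) : Vec3)).toReal =
      Literature.Analysis.FluidPDE.Torus.pairing (u : L2T3) fGP :=
    Literature.Analysis.FluidPDE.Torus.IsSteadyWeakSolution.energy_eq' (by simp) (hs.memLp 2) hV hsol
  have hR := Summit.AnomalousDissipation.AnomalousDissipation.Theorems.steadyWeakIsGlobalLerayHopf_proof ν fGP u hν hs hz hV hsol heq
  -- loudness of the heavy state
  have hloud : 4 * Real.pi ^ 2 * c ≤ Literature.Analysis.FluidPDE.meanDissipation ν (fun _ : ℝ => ((u : L2T3) : Vec3)) := by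
    rw [hR.2.2]
    have hP := poincare_of_mem_energySpaceV u hV
    have hπ : (0 : ℝ) ≤ 4 * Real.pi ^ 2 := by positivity
    calc 4 * Real.pi ^ 2 * c ≤ 4 * Real.pi ^ 2 * (ν * ∫ x, ‖(u : L2T3) x‖ ^ 2) := mul_le_mul_of_nonneg_left hcE hπ
      _ = ν * (4 * Real.pi ^ 2 * ∫ x, ‖(u : L2T3) x‖ ^ 2) := by ring
      _ ≤ ν * (Literature.Analysis.FunctionSpaces.Torus.eGradNormSq ((u : L2T3) : Vec3)).toReal :=
          mul_le_mul_of_nonneg_left hP hν.le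
  -- the ceiling applied to it
  have hceil := hE ν hν hν1 ((u : L2T3) : Vec3) (fun _ => ((u : L2T3) : Vec3))
    (Literature.Analysis.FluidPDE.Torus.integral_eq_zero_of_mem_energySpace u.2) hR.1 hloud
  rw [hR.2.1] at hceil
  -- but the energy exceeds E: ∫|u|² ≥ c/ν > c/ν₀ ≥ |E| + 1 > E
  have hEn : c / ν ≤ ∫ x, ‖(u : L2T3) x‖ ^ 2 := by
    rw [div_le_iff₀ hν]; linarith [hcE, mul_comm ν (∫ x, ‖(u : L2T3) x‖ ^ 2)]
  have h2 : |E| + 1 ≤ c / ν := by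
    have hle : ν ≤ c / (|E| + 1) := (hlt.trans_le (min_le_right _ _)).le
    rw [le_div_iff₀ hν]
    calc (|E| + 1) * ν ≤ (|E| + 1) * (c / (|E| + 1)) := mul_le_mul_of_nonneg_left hle hEpos.le
      _ = c := by field_simp
  have h3 : E < |E| + 1 := by linarith [le_abs_self E]
  linarith

/-! ## §Decomposition — the VirtualDissipation split: LambRigidGP ∧ LightSteadyStatesGP ⇒ GPLoudFamilyZ (PROVED; not filed) -/

/-- **The two cruxes of route VirtualDissipation imply this crux.** Verbatim the route's certified `closes` (ν-free Lamb rigidity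
+ light classical steady states ⇒ every light state is `min c δ₀²`-loud by the residual transfer), re-aimed at `GPLoudFamilyZ`
instead of the summit: the light steady states are zero-mean by hypothesis and their constant paths are global Leray–Hopf
solutions (`IsClassicalNSSolutionOn.isGlobalLerayHopf`) with `meanDissipation = ν_j‖∇u_j‖²`. -/
theorem GPLoudFamilyZ_of_virtualDissipation :
    VirtualDissipation.LambRigidGP → VirtualDissipation.LightSteadyStatesGP → FrustratedForces.GPLoudFamilyZ := by
  intro h₁ h₂
  obtain ⟨E, c, δ₀, hE2, hc, hδ₀, hrig⟩ := h₁
  obtain ⟨ν, u, p, hν, hν0, hsol, hmean, hlight⟩ := h₂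
  -- abstract the pinned force as an opaque local definition (so that `simp` does not split `⟪f_GP x, w x⟫` mode by mode)
  set F : UnitAddTorus (Fin 3) → EuclideanSpace ℝ (Fin 3) := fun x => (Literature.Analysis.FluidPDE.Torus.stokesMode (Pi.single (2 : Fin 3) (1 : ℤ)) (EuclideanSpace.single (0 : Fin 3) (1 : ℝ)) false x + Literature.Analysis.FluidPDE.Torus.stokesMode (Pi.single (0 : Fin 3) (1 : ℤ)) (EuclideanSpace.single (1 : Fin 3) (1 : ℝ)) false x + Literature.Analysis.FluidPDE.Torus.stokesMode (Pi.single (1 : Fin 3) (1 : ℤ)) (EuclideanSpace.single (2 : Fin 3) (1 : ℝ)) false x : EuclideanSpace ℝ (Fin 3)) with hF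
  obtain ⟨hfs, hfd, hfz⟩ :
      Literature.Analysis.FunctionSpaces.Torus.IsSmooth F ∧ Literature.Analysis.FunctionSpaces.Torus.IsDivFree F ∧
        Literature.Analysis.FunctionSpaces.Torus.HasZeroMean F :=
    Summit.AnomalousDissipation.AnomalousDissipation.Theorems.SteadyStatesLoudBounded.GpAdmissible.stub_gpAdmissible
  have hus : ∀ j, Literature.Analysis.FunctionSpaces.Torus.IsSmooth (u j) := fun j =>
    (hsol j).smooth_velocity.isSmooth_slice (Set.mem_univ (0 : ℝ))
  have hps : ∀ j, Literature.Analysis.FunctionSpaces.Torus.IsSmooth (p j) := fun j =>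
    (hsol j).smooth_pressure.isSmooth_slice (Set.mem_univ (0 : ℝ))
  have hud : ∀ j, Literature.Analysis.FunctionSpaces.Torus.IsDivFree (u j) := fun j =>
    (hsol j).divFree 0 (Set.mem_univ _)
  have hst : ∀ j, ∀ w : Vec3,
      Literature.Analysis.FunctionSpaces.Torus.IsSmooth w → Literature.Analysis.FunctionSpaces.Torus.IsDivFree w →
      Literature.Analysis.FunctionSpaces.Torus.HasZeroMean w →
      ∫ x, inner ℝ (ν j • Literature.Analysis.FunctionSpaces.Torus.laplacian (u j) x
        - Literature.Analysis.FunctionSpaces.Torus.convect (u j) (u j) x + F x) (w x) = 0 := by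
    intro j w hw hwd hwz
    have hpt : ∀ x, ν j • Literature.Analysis.FunctionSpaces.Torus.laplacian (u j) x
        - Literature.Analysis.FunctionSpaces.Torus.convect (u j) (u j) x + F x
        = Literature.Analysis.FunctionSpaces.Torus.gradient (p j) x := by
      intro x
      have h := (hsol j).momentum 0 (Set.mem_univ _) x
      have h0 : Literature.Analysis.FunctionSpaces.Torus.timeDerivWithin Set.univ
          (fun _ : ℝ => u j) 0 x = 0 := by
        simp [Literature.Analysis.FunctionSpaces.Torus.timeDerivWithin]
      rw [h0, zero_add] at h
      have h' : Literature.Analysis.FunctionSpaces.Torus.convect (u j) (u j) x =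
          ν j • Literature.Analysis.FunctionSpaces.Torus.laplacian (u j) x
            - Literature.Analysis.FunctionSpaces.Torus.gradient (p j) x + F x := h
      rw [h']
      abel
    simp_rw [hpt]
    exact Literature.Analysis.FunctionSpaces.Torus.integral_inner_gradient_eq_zero_of_isDivFree hw (hps j) hwd
  have hres : ∀ j, ∀ w : Vec3,
      Literature.Analysis.FunctionSpaces.Torus.IsSmooth w → Literature.Analysis.FunctionSpaces.Torus.IsDivFree w →
      Literature.Analysis.FunctionSpaces.Torus.HasZeroMean w →
      |∫ x, inner ℝ (Literature.Analysis.FunctionSpaces.Torus.convect (u j) (u j) x - F x) (w x)| ≤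
        (ν j * Real.sqrt (Literature.Analysis.FunctionSpaces.Torus.gradNormSq (u j))) *
          Real.sqrt (Literature.Analysis.FunctionSpaces.Torus.gradNormSq w) := by
    intro j w hw hwd hwz
    have hu := hus j
    have h0 := hst j w hw hwd hwz
    have iL : Integrable (fun x => inner ℝ (ν j • Literature.Analysis.FunctionSpaces.Torus.laplacian (u j) x) (w x)) volume :=
      ((hu.laplacian.smul (ν j)).inner hw).integrable
    have iC : Integrable (fun x => inner ℝ (Literature.Analysis.FunctionSpaces.Torus.convect (u j) (u j) x) (w x)) volume :=
      ((hu.convect hu).inner hw).integrable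
    have iF : Integrable (fun x => inner ℝ (F x) (w x)) volume := (hfs.inner hw).integrable
    have iLC : Integrable (fun x => inner ℝ (ν j • Literature.Analysis.FunctionSpaces.Torus.laplacian (u j) x) (w x)
        - inner ℝ (Literature.Analysis.FunctionSpaces.Torus.convect (u j) (u j) x) (w x)) volume := iL.sub iC
    simp_rw [inner_add_left, inner_sub_left] at h0
    rw [integral_add iLC iF, integral_sub iL iC] at h0
    have hlap : ∫ x, inner ℝ (ν j • Literature.Analysis.FunctionSpaces.Torus.laplacian (u j) x) (w x) =
        ν j * ∫ x, inner ℝ (w x) (Literature.Analysis.FunctionSpaces.Torus.laplacian (u j) x) := by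
      simp_rw [real_inner_smul_left]
      rw [integral_const_mul]
      exact congrArg _ (integral_congr_ae (ae_of_all _ fun x => real_inner_comm _ _))
    have heq : ∫ x, inner ℝ (Literature.Analysis.FunctionSpaces.Torus.convect (u j) (u j) x - F x) (w x) =
        ν j * ∫ x, inner ℝ (w x) (Literature.Analysis.FunctionSpaces.Torus.laplacian (u j) x) := by
      simp_rw [inner_sub_left]
      rw [integral_sub iC iF]
      linarith
    rw [heq, abs_mul, abs_of_nonneg (hν j).1.le, mul_assoc]
    refine mul_le_mul_of_nonneg_left ?_ (hν j).1.le
    rw [mul_comm]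
    exact Summit.AnomalousDissipation.AnomalousDissipation.Theorems.PhantomFloor.abs_integral_inner_laplacian_le hw hu
  have hfloor : ∀ j, min c (δ₀ ^ 2) ≤ ν j * Literature.Analysis.FunctionSpaces.Torus.gradNormSq (u j) := by
    intro j
    have hG : 0 ≤ Literature.Analysis.FunctionSpaces.Torus.gradNormSq (u j) :=
      Literature.Analysis.FunctionSpaces.Torus.gradNormSq_nonneg (u j)
    set R := ν j * Real.sqrt (Literature.Analysis.FunctionSpaces.Torus.gradNormSq (u j)) with hR
    have hR0 : 0 ≤ R := mul_nonneg (hν j).1.le (Real.sqrt_nonneg _)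
    have hRG : R * Real.sqrt (Literature.Analysis.FunctionSpaces.Torus.gradNormSq (u j)) =
        ν j * Literature.Analysis.FunctionSpaces.Torus.gradNormSq (u j) := by
      rw [hR, mul_assoc, Real.mul_self_sqrt hG]
    rcases le_or_gt R δ₀ with hle | hlt
    · have h := hrig (u j) (hus j) (hud j) (hmean j) ((hlight j).trans hE2) R hR0 (hres j) hle
      rw [hRG] at h
      exact (min_le_left _ _).trans h
    · have hR2 : R ^ 2 = ν j * (ν j * Literature.Analysis.FunctionSpaces.Torus.gradNormSq (u j)) := by
        rw [hR, mul_pow, Real.sq_sqrt hG]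
        ring
      have hδR : δ₀ ^ 2 < R ^ 2 := by nlinarith [hlt, hδ₀, hR0]
      have hX : ν j * (ν j * Literature.Analysis.FunctionSpaces.Torus.gradNormSq (u j)) ≤
          ν j * Literature.Analysis.FunctionSpaces.Torus.gradNormSq (u j) :=
        mul_le_of_le_one_left (mul_nonneg (hν j).1.le hG) (hν j).2
      have h' : δ₀ ^ 2 < ν j * (ν j * Literature.Analysis.FunctionSpaces.Torus.gradNormSq (u j)) := hR2 ▸ hδR
      exact (min_le_right _ _).trans (h'.trans_le hX).le
  refine ⟨min c (δ₀ ^ 2), lt_min hc (pow_pos hδ₀ 2), ν, fun j => u j, fun j _ => u j, hν, hν0, hmean,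
    fun j => (hsol j).isGlobalLerayHopf, fun j => ?_⟩
  rw [Literature.Analysis.FluidPDE.meanDissipation_eq_of_periodic (τ := 1) (fun _ => rfl) one_pos]
  have h := hfloor j
  rw [Literature.Analysis.FunctionSpaces.Torus.gradNormSq_eq_toReal_eGradNormSq_holds (hus j)] at h
  simpa using h

end Summit.AnomalousDissipation.AnomalousDissipation.Cruxes.GPLoudFamilyZ.StrategyCensus

end
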